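import Summits.CriticalPhenomena.PercolationContinuityZ3.Theorems.SahiMasterFamilyPhiOrbit
import Summits.CriticalPhenomena.PercolationContinuityZ3.Theorems.SahiMasterFamilyGHConjecture

/-!
# A kernel-checkable certificate format for `Φ_n ≥ 0` on the LINEAR union-closed relaxation `F^{UC}(n)` (covering atoms, orbit basis)

Unit `prim-masterthm-p4` (gen 16; crux anchor stmt-CriticalPhenomena-4575, helper work; memo
`run/shared/lean/prim/prim-masterthm/prim-masterthm-p4/P4-GEN16-REPORT.md` §3).  Re-uses the syntax and the ORBIT-BASIS check of
`…PhiCertPoly` / `…PhiCert` / `…PhiOrbit` (gen 13: `Poly`, `evalP`, `normP`, `symEN`, `actV`, `evalSym`, `recon`, `checkDZ`, `Msum_relabel`),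
replacing the atoms of `F(n)` (`β_S`, `1 − β_S`, `β_S − β_Aβ_B`) by the atoms of the union-closed polytope:
* `UAtom.b S` = `β_S`, `UAtom.d S` = `1 − β_S` (box), and the **covering atoms** `UAtom.u B [A_1,…,A_m]` =
  `1 + (m−1)·β_B − Σ_i β_{A_i}` for sets `A_i` that PAIRWISE COVER `B` (`A_i ∪ A_j = B`, `i ≠ j`; list positions, duplicates of `B` allowed)
  — valid on every mixture of indicators of union-closed families because pointwise, if `B ∉ 𝒰`, at most one `A_i` lies in `𝒰`.
* `FUCNonneg n` — **`F^{UC}(n)`** typed: `Φ_n(β) ≥ 0` for every `β` in the box with `β_univ = 1` satisfying all pairwise-covering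
  inequalities (list form).  `ucHullNonneg_of_fucNonneg : FUCNonneg n → UCHullNonneg n`.
* `utermsPoly_nonneg` (soundness of checked certificates), `actV` preserves the constraints (`actV_cover`), and the reflection theorem
  **`fucNonneg_of_orbitPiecesU`**: the four finite checks (data well formed; `normP (Q − M·Φ_n) = RD`; relabelled orbit data `= RD`;
  orbit-class sums zero) prove `FUCNonneg (n+1)` with standard axioms.
The order-five certificate (27 symmetry classes, kit j137571) is checked in `…UCCertFive`.  HONEST FRAMING: infrastructure; `F^{UC}(n)` /
`(UC-hull)_n` OPEN for `n ≥ 6`; Sahi's `C_k`, (GH)_k = PC-k (k ≥ 8) and the master theorem remain OPEN.  Axioms standard. [this work]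
-/

set_option autoImplicit false

namespace Summit.CriticalPhenomena.PercolationContinuityZ3.Theorems

namespace PhiCert

open Finset Literature.Combinatorics.Sahi2008

/-! ## The linear union-closed relaxation `F^{UC}(n)`, typed -/

/-- **`F^{UC}(n)`**: `Φ_n(β) ≥ 0` whenever `0 ≤ β ≤ 1`, `β univ = 1` and, for every `B` and every list of sets pairwise covering `B`,
`Σ_i β_{A_i} ≤ 1 + (m−1)·β_B`.  A conjecture-valued definition (true for `n ≤ 5`: `…UCHullFour`, `…UCCertFive`). [this work]
[status: open for n ≥ 6] -/
@[conjecture] def FUCNonneg (n : ℕ) : Prop :=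
  ∀ β : Finset (Fin n) → ℝ, (∀ B, 0 ≤ β B) → (∀ B, β B ≤ 1) → β univ = 1 →
    (∀ (B : Finset (Fin n)) (L : List (Finset (Fin n))), L.Pairwise (fun A A' => A ∪ A' = B) →
      (L.map β).sum ≤ 1 + ((L.length : ℝ) - 1) * β B) →
    0 ≤ PrincipalCapBeta.phiSet n β

/-! ## Covering atoms -/

/-- Atoms of the union-closed relaxation: `β_S`, `1 − β_S`, and `1 + (m−1)β_B − Σ_{A∈As} β_A`. [this work] -/
inductive UAtom
  | b (S : ℕ)
  | d (S : ℕ)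
  | u (B : ℕ) (As : List ℕ)
  deriving DecidableEq, Repr

/-- The polynomial `Σ_{A∈As} β_A`. [this work] -/
def sumMono (n : ℕ) : List ℕ → Poly
  | [] => []
  | A :: As => mono n A ++ sumMono n As

/-- The polynomial of a covering atom. [this work] -/
def uatomPoly (n : ℕ) : UAtom → Poly
  | .b S => mono n S
  | .d S => ([], 1) :: scaleP (-1) (mono n S)
  | .u B As => ([], 1) :: (scaleP ((As.length : ℤ) - 1) (mono n B) ++ scaleP (-1) (sumMono n As))

/-- The value of a covering atom. [this work] -/
noncomputable def uatomVal (v : ℕ → ℝ) : UAtom → ℝ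
  | .b S => v S
  | .d S => 1 - v S
  | .u B As => 1 + ((As.length : ℝ) - 1) * v B - (As.map v).sum

/-- All position pairs of the list cover `B`: `A_i ||| A_j = B` for `i < j`. [this work] -/
def coverList (B : ℕ) : List ℕ → Bool
  | [] => true
  | A :: As => (As.all fun A' => (A ||| A') == B) && coverList B As

/-- Well-formedness of atoms: covering lists cover. [this work] -/
def UAtom.wf : UAtom → Bool
  | .u B As => coverList B As
  | _ => true

/-- `sumMono` evaluates to the sum of the values. [this work] -/
theorem evalP_sumMono {n : ℕ} (β : Finset (Fin n) → ℝ) (huniv : β univ = 1) :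
    ∀ As : List ℕ, evalP (val β) (sumMono n As) = (As.map (val β)).sum
  | [] => by rw [sumMono, evalP, List.map_nil, List.sum_nil]
  | A :: As => by rw [sumMono, evalP_append, evalP_mono β huniv, evalP_sumMono β huniv As, List.map_cons, List.sum_cons]

/-- `uatomPoly` evaluates to `uatomVal`. [this work] -/
theorem evalP_uatomPoly {n : ℕ} (β : Finset (Fin n) → ℝ) (huniv : β univ = 1) (a : UAtom) :
    evalP (val β) (uatomPoly n a) = uatomVal (val β) a := by
  cases a with
  | b S => rw [uatomPoly, uatomVal, evalP_mono β huniv]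
  | d S => rw [uatomPoly, uatomVal, evalP, evalP_scaleP, evalP_mono β huniv, evalM]; push_cast; ring
  | u B As =>
    rw [uatomPoly, uatomVal, evalP, evalP_append, evalP_scaleP, evalP_scaleP, evalP_mono β huniv, evalP_sumMono β huniv, evalM]
    push_cast; ring

/-- A covering list of masks gives a pairwise-covering list of sets. [this work] -/
theorem pairwise_ofMask_of_coverList {n : ℕ} (B : ℕ) : ∀ As : List ℕ, coverList B As = true →
    (As.map (ofMask n)).Pairwise (fun A A' => A ∪ A' = ofMask n B)
  | [], _ => List.Pairwise.nil
  | A :: As, h => by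
    rw [coverList, Bool.and_eq_true, List.all_eq_true] at h
    rw [List.map_cons, List.pairwise_cons]
    refine ⟨fun A' hA' => ?_, pairwise_ofMask_of_coverList B As h.2⟩
    obtain ⟨a, ha, rfl⟩ := List.mem_map.1 hA'
    have hab : (A ||| a) = B := by simpa using h.1 a ha
    rw [← ofMask_or, hab]

/-- Covering atoms are nonnegative on `F^{UC}(n)`. [this work] -/
theorem uatomVal_nonneg {n : ℕ} (β : Finset (Fin n) → ℝ) (h0 : ∀ B, 0 ≤ β B) (h1 : ∀ B, β B ≤ 1)
    (hcov : ∀ (B : Finset (Fin n)) (L : List (Finset (Fin n))), L.Pairwise (fun A A' => A ∪ A' = B) →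
      (L.map β).sum ≤ 1 + ((L.length : ℝ) - 1) * β B)
    (a : UAtom) (ha : a.wf = true) : 0 ≤ uatomVal (val β) a := by
  cases a with
  | b S => exact h0 _
  | d S => rw [uatomVal]; exact sub_nonneg.2 (h1 _)
  | u B As =>
    have hc : coverList B As = true := by simpa [UAtom.wf] using ha
    have key := hcov (ofMask n B) (As.map (ofMask n)) (pairwise_ofMask_of_coverList B As hc)
    rw [List.map_map, List.length_map] at key
    have e : (As.map (β ∘ ofMask n)).sum = (As.map (val β)).sum := rfl
    rw [uatomVal, ← e]
    have : val β B = β (ofMask n B) := rfl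
    rw [this]
    linarith

/-- The polynomial of a product of covering atoms. [this work] -/
def uprodP (n : ℕ) : List UAtom → Poly
  | [] => [([], 1)]
  | a :: as => mulP (uatomPoly n a) (uprodP n as)

/-- `uprodP` evaluates to the product of the atom values. [this work] -/
theorem evalP_uprodP {n : ℕ} (β : Finset (Fin n) → ℝ) (huniv : β univ = 1) :
    ∀ as : List UAtom, evalP (val β) (uprodP n as) = (as.map (uatomVal (val β))).prod
  | [] => by rw [uprodP, evalP, evalP, evalM, List.map_nil, List.prod_nil]; push_cast; ring
  | a :: as => by rw [uprodP, evalP_mulP, evalP_uatomPoly β huniv, evalP_uprodP β huniv as, List.map_cons, List.prod_cons]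

/-- The polynomial of a weighted list of products. [this work] -/
def utermsPoly (n : ℕ) : List (ℤ × List UAtom) → Poly
  | [] => []
  | t :: T => scaleP t.1 (uprodP n t.2) ++ utermsPoly n T

/-- `utermsPoly` with each product normalised (smaller kernel work). [this work] -/
def utermsPolyN (n : ℕ) : List (ℤ × List UAtom) → Poly
  | [] => []
  | t :: T => normP (scaleP t.1 (uprodP n t.2)) ++ utermsPolyN n T

/-- `utermsPolyN` evaluates like `utermsPoly`. [this work] -/
theorem evalP_utermsPolyN {n : ℕ} (v : ℕ → ℝ) : ∀ T : List (ℤ × List UAtom), evalP v (utermsPolyN n T) = evalP v (utermsPoly n T)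
  | [] => rfl
  | t :: T => by rw [utermsPolyN, utermsPoly, evalP_append, evalP_append, evalP_normP, evalP_utermsPolyN v T]

/-- Data check: nonnegative weights and well-formed atoms. [this work] -/
def ucheckT : List (ℤ × List UAtom) → Bool
  | [] => true
  | t :: T => (decide (0 ≤ t.1) && t.2.all UAtom.wf) && ucheckT T

/-- **Soundness of certificates** on `F^{UC}(n)`. [this work] -/
theorem utermsPoly_nonneg {n : ℕ} (β : Finset (Fin n) → ℝ) (h0 : ∀ B, 0 ≤ β B) (h1 : ∀ B, β B ≤ 1) (huniv : β univ = 1)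
    (hcov : ∀ (B : Finset (Fin n)) (L : List (Finset (Fin n))), L.Pairwise (fun A A' => A ∪ A' = B) →
      (L.map β).sum ≤ 1 + ((L.length : ℝ) - 1) * β B) :
    ∀ T : List (ℤ × List UAtom), ucheckT T = true → 0 ≤ evalP (val β) (utermsPoly n T)
  | [], _ => by rw [utermsPoly, evalP]
  | t :: T, hT => by
    rw [ucheckT, Bool.and_eq_true, Bool.and_eq_true] at hT
    obtain ⟨⟨hw, hwf⟩, hT'⟩ := hT
    rw [utermsPoly, evalP_append, evalP_scaleP, evalP_uprodP β huniv]
    refine add_nonneg (mul_nonneg (by exact_mod_cast of_decide_eq_true hw) (List.prod_nonneg fun x hx => ?_))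
      (utermsPoly_nonneg β h0 h1 huniv hcov T hT')
    obtain ⟨a, ha, rfl⟩ := List.mem_map.1 hx
    exact uatomVal_nonneg β h0 h1 hcov a (List.all_eq_true.1 hwf a ha)

/-! ## Relabelling preserves the covering constraints -/

/-- The covering hypotheses are invariant under relabelling the ground set. [this work] -/
theorem actV_cover {n : ℕ} (σ : Equiv.Perm (Fin n)) (β : Finset (Fin n) → ℝ)
    (hcov : ∀ (B : Finset (Fin n)) (L : List (Finset (Fin n))), L.Pairwise (fun A A' => A ∪ A' = B) →
      (L.map β).sum ≤ 1 + ((L.length : ℝ) - 1) * β B)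
    (B : Finset (Fin n)) (L : List (Finset (Fin n))) (hL : L.Pairwise (fun A A' => A ∪ A' = B)) :
    (L.map (actV σ β)).sum ≤ 1 + ((L.length : ℝ) - 1) * actV σ β B := by
  have hL' : (L.map fun A => A.map σ.toEmbedding).Pairwise (fun A A' => A ∪ A' = B.map σ.toEmbedding) := by
    rw [List.pairwise_map]
    exact hL.imp fun {A A'} h => by rw [← Finset.map_union, h]
  have key := hcov (B.map σ.toEmbedding) (L.map fun A => A.map σ.toEmbedding) hL'
  rw [List.map_map, List.length_map] at key
  exact key

/-! ## The orbit-basis check for covering certificates and its soundness -/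

section Sound

variable {n : ℕ}

/-- **REFLECTION, ORBIT BASIS, IN PIECES**: the finite checks (certificate data well formed; orbit data well formed with vanishing class sums;
the normal form `RD` of `R = Q − M·Φ_{n+1}`; the relabelled orbit data reproduces `RD`) prove `F^{UC}(n+1)` with standard axioms. [this work] -/
theorem fucNonneg_of_orbitPiecesU (n M : ℕ) (hM : 0 < M) (C : List (ℤ × List UAtom)) (D : List (ℤ × List ℕ × Mono)) (RD : Poly)
    (hT : ucheckT C = true) (hDZ : checkDZ (n + 1) D = true)
    (hR : normP (utermsPolyN (n + 1) C ++ scaleP (-(M : ℤ)) (symEN (n + 1) (n + 1) fun i => 2 ^ (i : ℕ))) = RD)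
    (hrec : D.map (recon (n + 1)) = RD) : FUCNonneg (n + 1) := by
  intro β h0 h1 huniv hcov
  rw [checkDZ, Bool.and_eq_true, decide_eq_true_eq] at hDZ
  obtain ⟨hD, hzero⟩ := hDZ
  set R : Poly := utermsPolyN (n + 1) C ++ scaleP (-(M : ℤ)) (symEN (n + 1) (n + 1) fun i => 2 ^ (i : ℕ)) with hRdef
  have hR0 : evalSym β R = 0 := by
    rw [← evalSym_normP, hR, ← hrec, evalSym_recon β D hD, ← evalSym_normP, hzero]
    simp [evalSym, evalP]
  have hu : ∀ σ : Equiv.Perm (Fin (n + 1)), actV σ β univ = 1 := fun σ => by rw [actV_univ, huniv]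
  have hRσ : ∀ σ : Equiv.Perm (Fin (n + 1)), evalP (val (actV σ β)) R =
      evalP (val (actV σ β)) (utermsPoly (n + 1) C) - (M : ℝ) * PrincipalCapBeta.phiSet (n + 1) β := by
    intro σ
    rw [hRdef, evalP_append, evalP_scaleP, evalP_utermsPolyN, evalP_symEN_singletons _ (hu σ), phiSet_actV]
    push_cast
    ring
  have hsum : evalSym β R = (∑ σ : Equiv.Perm (Fin (n + 1)), evalP (val (actV σ β)) (utermsPoly (n + 1) C)) -
      ((Nat.factorial (n + 1) : ℕ) : ℝ) * ((M : ℝ) * PrincipalCapBeta.phiSet (n + 1) β) := by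
    unfold evalSym
    rw [Finset.sum_congr rfl fun σ _ => hRσ σ, Finset.sum_sub_distrib, Finset.sum_const, Finset.card_univ,
      Fintype.card_perm, Fintype.card_fin, nsmul_eq_mul]
  have hQ : 0 ≤ ∑ σ : Equiv.Perm (Fin (n + 1)), evalP (val (actV σ β)) (utermsPoly (n + 1) C) :=
    Finset.sum_nonneg fun σ _ => utermsPoly_nonneg (actV σ β) (fun B => h0 _) (fun B => h1 _) (hu σ)
      (actV_cover σ β hcov) C hT
  have hfac : (0 : ℝ) < ((Nat.factorial (n + 1) : ℕ) : ℝ) := by exact_mod_cast Nat.factorial_pos (n + 1)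
  have hM' : (0 : ℝ) < (M : ℝ) := by exact_mod_cast hM
  have key : ((Nat.factorial (n + 1) : ℕ) : ℝ) * ((M : ℝ) * PrincipalCapBeta.phiSet (n + 1) β) =
      ∑ σ : Equiv.Perm (Fin (n + 1)), evalP (val (actV σ β)) (utermsPoly (n + 1) C) := by
    linarith [hsum, hR0]
  have h3 : 0 ≤ (M : ℝ) * PrincipalCapBeta.phiSet (n + 1) β :=
    (mul_nonneg_iff_of_pos_left hfac).1 (key ▸ hQ)
  exact (mul_nonneg_iff_of_pos_left hM').1 h3

end Sound

/-! ## From the linear relaxation to the union-closed polytope -/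

/-- Pointwise covering inequality for one union-closed family: among sets pairwise covering `B`, at most one lies in `𝒰` unless `B ∈ 𝒰`.
[this work] -/
theorem sum_indicator_le_of_unionClosed {n : ℕ} (𝒰 : Finset (Finset (Fin n))) (hUC : ∀ A ∈ 𝒰, ∀ A' ∈ 𝒰, A ∪ A' ∈ 𝒰)
    (B : Finset (Fin n)) : ∀ L : List (Finset (Fin n)), L.Pairwise (fun A A' => A ∪ A' = B) →
      (L.map fun A => if A ∈ 𝒰 then (1 : ℝ) else 0).sum ≤ 1 + ((L.length : ℝ) - 1) * (if B ∈ 𝒰 then (1 : ℝ) else 0) := by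
  by_cases hB : B ∈ 𝒰
  · -- every indicator is at most one
    intro L _
    rw [if_pos hB, mul_one]
    have : (L.map fun A => if A ∈ 𝒰 then (1 : ℝ) else 0).sum ≤ (L.map fun _ => (1 : ℝ)).sum :=
      List.sum_le_sum fun A _ => by split_ifs <;> norm_num
    rw [List.map_const', List.sum_replicate, nsmul_eq_mul, mul_one] at this
    linarith
  · intro L hL
    rw [if_neg hB, mul_zero, add_zero]
    induction L with
    | nil => simp
    | cons A L ih =>
      rw [List.pairwise_cons] at hL
      rw [List.map_cons, List.sum_cons]
      by_cases hA : A ∈ 𝒰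
      · -- then no other member is in 𝒰
        have htail : (L.map fun A => if A ∈ 𝒰 then (1 : ℝ) else 0) = L.map fun _ => (0 : ℝ) := by
          refine List.map_congr_left fun A' hA' => ?_
          have hA'U : A' ∉ 𝒰 := fun h => hB (hL.1 A' hA' ▸ hUC A hA A' h)
          rw [if_neg hA'U]
        rw [if_pos hA, htail, List.map_const', List.sum_replicate, nsmul_zero, add_zero]
      · rw [if_neg hA, zero_add]
        exact ih hL.2

/-- **`F^{UC}(n) ⇒ (UC-hull)_n`**: mixtures of indicators of union-closed families containing `univ` lie in `F^{UC}(n)`. [this work] -/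
theorem ucHullNonneg_of_fucNonneg {n : ℕ} (h : FUCNonneg n) : GHConjecture.UCHullNonneg n := by
  intro α _ w 𝒰 hw0 hw1 hUC htop
  set β : Finset (Fin n) → ℝ := fun S => ∑ x, w x * (if S ∈ 𝒰 x then (1 : ℝ) else 0) with hβ
  have h0 : ∀ B, 0 ≤ β B := fun B => sum_nonneg fun x _ => mul_nonneg (hw0 x) (by split_ifs <;> norm_num)
  have h1 : ∀ B, β B ≤ 1 := fun B => by
    calc β B ≤ ∑ x, w x * 1 := sum_le_sum fun x _ => mul_le_mul_of_nonneg_left (by split_ifs <;> norm_num) (hw0 x)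
      _ = 1 := by rw [← sum_mul, hw1, one_mul]
  have huniv : β univ = 1 := by
    have : ∀ x, w x * (if (univ : Finset (Fin n)) ∈ 𝒰 x then (1 : ℝ) else 0) = w x := fun x => by rw [if_pos (htop x), mul_one]
    simp only [hβ, this, hw1]
  have hcov : ∀ (B : Finset (Fin n)) (L : List (Finset (Fin n))), L.Pairwise (fun A A' => A ∪ A' = B) →
      (L.map β).sum ≤ 1 + ((L.length : ℝ) - 1) * β B := by
    intro B L hL
    -- exchange the two sums and apply the pointwise inequality for each `x`
    have e1 : (L.map β).sum = ∑ x, w x * (L.map fun A => if A ∈ 𝒰 x then (1 : ℝ) else 0).sum := by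
      induction L with
      | nil => simp [hβ]
      | cons A L ih =>
        rw [List.pairwise_cons] at hL
        rw [List.map_cons, List.sum_cons, ih hL.2]
        simp only [hβ, List.map_cons, List.sum_cons, mul_add, sum_add_distrib]
    have e2 : (1 : ℝ) + ((L.length : ℝ) - 1) * β B =
        ∑ x, w x * (1 + ((L.length : ℝ) - 1) * (if B ∈ 𝒰 x then (1 : ℝ) else 0)) := by
      simp only [hβ, mul_add, sum_add_distrib, ← sum_mul, hw1, one_mul, mul_sum]
      refine congrArg _ (sum_congr rfl fun x _ => ?_)
      ring
    rw [e1, e2]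
    exact sum_le_sum fun x _ => mul_le_mul_of_nonneg_left (sum_indicator_le_of_unionClosed (𝒰 x) (hUC x) B L hL) (hw0 x)
  exact h β h0 h1 huniv hcov

end PhiCert

end Summit.CriticalPhenomena.PercolationContinuityZ3.Theorems
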